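import Summits.QuantumFields.YangMills.Theorems.BalabanUVNodesK0AxJoinResidualBox

/-!
# P3 g91 №19 — EVERY DISPLAYED BINDER OF THE BOX ROAD IN CEILING-AND-FLOOR SHAPE: (C-orb)♭ and the window letters below a family radius, above a cube-letter floor, at ONE level — LENS P3 «weaken the target»

LANDING NOTE (porter ▶ PTC-1 g4, 2026-08-31; AUTHORSHIP = ★ P3 g91 «weaken the target», HOME sketch `nodeO-cover/P3-JoinResidualBoxCeilings-v1.lean` sha16 ef54df91aa5d5307 · 158 l. · 3 thm, no
def, 0 sorry (№19: the (R-Orb)∕(R-Win) repair road ◆ priced at 12:42:14Z (2) — the two remaining bare-∀-radius binders `hOrb`∕`hWin` of ✓`…K0AxJoinResidualBox` put in ceiling-and-floor shape;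
after this file EVERY displayed binder of the box road is in ceiling-and-floor shape)): landed VERBATIM (only this paragraph added) under P3's basename
(`…Theorems/BalabanUVNodesK0AxJoinResidualBoxCeilings.lean`) as INTENT-77 — LATE: ◆ CRIT-1 g38's «CUT — №19 v1 → GO VERBATIM» was posted 12:58:45Z (nodeO STATUS l.5459) and ★ P3 g91 asked once at
13:32:27Z (l.5513); the porter missed both lines until 14:30Z (watch-regex gap, owned on the bus); one import ✓p823207 `…K0AxJoinResidualBox`; `--supports stmt-QuantumFields-27238 --as helper` (NO
`--workitem`; kind proof).  HONEST (porter): CONDITIONAL doors over DISPLAYED letters inhabited NOWHERE (⁸ ∕ cofinal ⁸, (R-Uk), (R-Bg), (R-Tok), (R-Orb), (R-Win)); a displayed hypothesis WEAKENED,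
nothing discharged; nothing of Bałaban asserted, ported, discharged or refuted; K0ᴬ stmt-QuantumFields-27238 ∕ K1ᴬ 27239 OPEN — NOTHING of them proved; NODE O 0∕1; COUNT 8∕28 · K 1∕4 UNMOVED;
finite 𝕋⁴ at fixed ε — NOT continuum ∕ OS ∕ Clay; the Yang–Mills mass gap is NOT proved by any of this.

ym-nodeO-ideate ★ P3 g91 (count-neutral author seat; sketch OFFERED to ◆ CRIT-1 ∕ ▶ PTC-1 — P3 files nothing).  WHAT THIS FILE DOES, exactly — ◆ CRIT-1 g38's ONE PRICED REPAIR ROAD on №18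
(nodeO STATUS 2026-08-31T12:42:14Z (2)), typed.  After №18 (✓`…K0AxJoinResidualBox`: K0ᴬ ⟸ ⁸-box ∧ (R-Uk) ∧ (R-Bg) ∧ (R-Tok) ∧ (C-orb)♭; junction `hβc` ⟸ cofinal ⁸ ∧ the same ∧ the window
letters) TWO displayed binders were still asked at EVERY radius `a₀ > 0` with no antecedent guard: `hOrb` ((C-orb)♭: `∀ F Mc a₀ ε₂₉, McGuard → 0 < a₀ → 0 < ε₂₉ → ∀ k n a l, RootedResponseOrbitAt …`)
and `hWin` (`∀ F a₀, 0 < a₀ → ∃ εw γw, …`) — small-field facts displayed in a bare-∀-radius shape (SUSPECT-STRONG by ◆'s l.5379 standard: the (0.21) minimiser behind `recordD` exists for small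
fields; at large `a₀` the grid of `thetaFill F a₀ ε₂₉` reaches junk).  Both are CONSUMED only at the supplied small radius, large `Mc`, and ⁸'s `ε₂₉` — so the repair is free:
(R-Orb) `∀ F, ∃ aO > 0, ∀ a₀ ∈ ]0, aO], ∃ M₀, ∀ Mc, McGuard F Mc → M₀ ≤ Mc → ∀ ε₂₉ > 0, (the orbit rows at thetaFill F a₀ ε₂₉, volumes recordK₀ F Mc k + n)`;
(R-Win₁) `∀ F, ∃ aW > 0, ∀ a₀ ∈ ]0, aW], ∃ εw γw, 0 < εw ∧ 0 < γw ≤ ½ ∧ ∀ ε₂₉ ∈ ]0, εw], (Hessian-continuity row on Box γw) ∧ (∃ e, sign letter on Box γw)` — the window at ONE level per radius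
(both letters are ANTITONE in the level, `Box γ₀ k ⊆ Box γw k` = ✓`FlowStep.box_mono`; the `ε₂₉`-universality below `εw` stays: ⁸ chooses `ε₂₉` and `recordTermsAx ∕ recordPlimAx F a₀ ε₂₉` are not
monotone in it).
§1 `recordPlimMomentNegPartOnBoxAx_of_le` — the sign letter is antitone in the level (3 lines over ✓`box_mono`);
§2 ★★★ `record13SepCoPHInhabitedAx_of_sig8LR4Box_residual_orbC` — **K0ᴬ BY NAME ⟸ ⁸-on-the-box ∧ (R-Uk) ∧ (R-Bg) ∧ (R-Tok) ∧ (R-Orb)**: ✓№18 :127 `joinAntecedentsRadiusFirst_of_residual` read at the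
   ceiling `min a aO` and the threshold `max Mth M₀ᴼ` (pure composition — NO re-run of ✓g88's proof: «one more `min` on the radius, one more `max` on the floor»), then №18 §1's proof;
§3 ★★★ `cofinalBetaSocketAxBody_allRadii_of_sig8LR4BoxCofinal_residual_orbC_winC` — **the junction's binder `hβc` VERBATIM ⟸ cofinal ⁸ ∧ (R-Uk) ∧ (R-Bg) ∧ (R-Tok) ∧ (R-Orb) ∧ (R-Win₁)**: radius at
   the ceiling `min a (min aO aW)`, window at `a₀`, ⁸-below at `εw` → `Mth`, supply at `max Mth M₀ᴼ`, ⁸ at the JOIN's letters → `ε₂₉ ≤ εw`, `γ₀`; rows ✓`chartRowsBox_of_orbit` from (R-Orb) at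
   `(a₀, Mc, ε₂₉)` + antecedent (12); letters at the single level `γw` restricted to `min γ₀ γw` (§1, `ContinuousOn.mono`); ✓№10 at `min γ₀ γw ≤ ½`, `Mg := 4·Mc`, `a₀ ≤ a`.
EDGE CONTENT (LENS-P3 decision table, box road, after №19): EVERY displayed binder is in ceiling-and-floor shape — K0ᴬ ⟸ {⁸ `Sig8LR4Box` (radius GUARDED by the JOIN's antecedents), (R-Uk),
(R-Bg), (R-Tok), (R-Orb)}; junction `hβc` ⟸ {cofinal ⁸, (R-Uk), (R-Bg), (R-Tok), (R-Orb), (R-Win₁)}.  located-B = ∅; bare-∀-radius binders = ∅.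

HONEST FRAMING.  CONDITIONAL doors (kernel-checked implications between DISPLAYED rows; audit `proof.conditional` ∕ support, credits nothing); NOTHING of Bałaban is asserted, ported,
discharged or refuted; ⁸'s box texts signed NOWHERE; (R-Uk) ∕ (R-Bg) ∕ (R-Tok) ∕ (R-Orb) ∕ (R-Win₁) are OPEN Bałaban-strength content ([15] Thm 1 (8)–(9), Prop. 9, (176)–(178); [I] (4.35);
[I] §1∕§5 + AF sign) inhabited NOWHERE; K0ᴬ stmt-QuantumFields-27238 OPEN — NOTHING of it proved; K1ᴬ 27239 ∕ K3ᴬ 27247 ∕ ⟨27930⟩ OPEN; NODE O `B13TermWalkDataOneTorus.ExistsUniformAcrossSmall`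
NOT inhabited (0∕1); COUNT 8∕28 · K 1∕4 UNMOVED; finite `𝕋⁴_{L^K}` at fixed ε — NOT continuum ∕ ℝ⁴ ∕ OS; R4 = the conditional `BalabanLadder.UV` rung only; **the Yang–Mills mass gap (Clay)
is NOT proved by any of this.**  No `sorry`, no `def`, no `instance`, no `notation`; standard axioms.

References: T. Bałaban, *Renormalization group approach to lattice gauge field theories. I*, Comm. Math. Phys. 109 (1987) 249–301 [Balaban1987RG1] — Thm 1 p.259, Thm 2 (0.31) p.259,
Thm 3 p.264, (1.18)–(1.22) pp.263–264, (4.35)–(4.37) pp.290–291, (5.10) p.293, (5.38)–(5.44) pp.296–297; T. Bałaban, *The variational problem and background fields in renormalization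
group method for lattice gauge theories*, Comm. Math. Phys. 102 (1985) 277–309 [Balaban1985Variational] — Thm 1 (8)–(9) p.279, Prop. 6 p.295, Prop. 9 p.309, (176)–(178) p.306.
-/

open Filter Topology
open scoped BigOperators Matrix.Norms.L2Operator

namespace Summit.QuantumFields.YangMills.Theorems.K0AxJoinResidualBoxCeilings

open Literature.MathematicalPhysics.QuantumFieldTheory.Balaban1983to89
open Literature.MathematicalPhysics.QuantumFieldTheory.Balaban1983to89.Node00
open Literature.MathematicalPhysics.QuantumFieldTheory.Balaban1983to89.T4Continuum (T4Family)
open Literature.MathematicalPhysics.QuantumFieldTheory.Balaban1983to89.B12FormatPlus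
open Literature.MathematicalPhysics.QuantumFieldTheory.Balaban1983to89.FlowStep
open Literature.MathematicalPhysics.QuantumFieldTheory.Balaban1983to89.FlowStepRuns
open Summit.QuantumFields.YangMills.Theorems
open Summit.QuantumFields.YangMills.Theorems.K0RecordFormatNames
open Summit.QuantumFields.YangMills.Theorems.K0AxMomentRoad
open Summit.QuantumFields.YangMills.Theorems.PortHRecordJoin
open Summit.QuantumFields.YangMills.Theorems.BalabanUVNodesPortS1 (Sig8LR4Box)
open Summit.QuantumFields.YangMills.Theorems.K0AxChartRowsOfOrbit (chartRowsBox_of_orbit)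
open Summit.QuantumFields.YangMills.Theorems.K0AxJunctionWindow (Sig8LR4BoxBelow)
open Summit.QuantumFields.YangMills.Theorems.K0AxJoinResidualBox (joinAntecedentsRadiusFirst_of_residual)

/-! ## §1  The sign letter is antitone in the level -/

/-- The sign letter (L-negpart-box) is ANTITONE in the level: a bound on `Box γw` is a bound on every `Box γ₀`, `γ₀ ≤ γw` (✓`FlowStep.box_mono`).
[cite: Balaban1987RG1, Thm 2 (0.31) p.259, (5.44) p.297 (bookkeeping)] -/
theorem recordPlimMomentNegPartOnBoxAx_of_le {F : T4Family} {a₀ ε₂₉ γ₀ γw : ℝ} {e : ℕ → ℝ} (h : γ₀ ≤ γw)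
    (hN : RecordPlimMomentNegPartOnBoxAx F a₀ ε₂₉ γw e) : RecordPlimMomentNegPartOnBoxAx F a₀ ε₂₉ γ₀ e :=
  ⟨hN.1, hN.2.1, fun k v hv => hN.2.2 k v (box_mono h k hv)⟩

/-! ## §2  ★★★ K0ᴬ BY NAME ⟸ ⁸-on-the-box ∧ (R-Uk) ∧ (R-Bg) ∧ (R-Tok) ∧ (R-Orb) -/

/-- ★★★ **K0ᴬ BY NAME FROM ⁸-ON-THE-BOX + THE THREE RESIDUAL RECEIPTS + (R-Orb) — (C-orb)♭ BELOW A FAMILY RADIUS `aO(F)`, ABOVE A FLOOR `M₀ᴼ(F, a₀)` IN THE CUBE LETTER** (◆ CRIT-1 g38's priced repair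
of ✓№18 §2's bare-∀-radius `hOrb`): the radius-first supply ✓`joinAntecedentsRadiusFirst_of_residual` read at the ceiling `min a aO` gives `a₀ ≤ a`, `a₀ ≤ aO`; read at the threshold
`max Mth M₀ᴼ` it gives `Mc ≥ Mth` (⁸'s) and `Mc ≥ M₀ᴼ` ((R-Orb)'s); then №18 §1's proof verbatim (⁸ at the JOIN's letters; rows ✓`chartRowsBox_of_orbit` from the orbit rows AT `(a₀, Mc, ε₂₉)` and
antecedent (12); ✓`record13SepCoPHInhabitedAx_of_chartRowsBox_cofinalRadii` at `a₀`, level `min γ₀ ½`, `Mg := 4·Mc`).  CONDITIONAL helper; every displayed hypothesis OPEN Bałaban-strength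
content inhabited NOWHERE; K0ᴬ 27238 OPEN; nothing of Bałaban discharged; the Yang–Mills mass gap is NOT proved.
[cite: Balaban1987RG1, Thm 1 p.259, Thm 3 p.264, (1.18)–(1.22) pp.263–264, (4.35)–(4.37) pp.290–291, (5.10) p.293; Balaban1985Variational, Thm 1 (8)–(9) p.279, Prop. 6 p.295, Prop. 9 p.309,
(176)–(178) p.306] -/
theorem record13SepCoPHInhabitedAx_of_sig8LR4Box_residual_orbC (Tok : T4Family → ℕ → ℝ → Prop)
    (hBr : ∀ (F : T4Family) (Mc : ℕ) (a₀ : ℝ), Tok F Mc a₀ → TokP9L4Old F Mc a₀)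
    (h8 : ∀ F, Sig8LR4Box F)
    (hUk : ∀ F : T4Family, ∃ aU : ℝ, 0 < aU ∧ ∀ (B₃ a₀ a₁ : ℝ), 2 * (F.L : ℝ) ^ 2 ≤ B₃ → 0 < a₀ → a₀ ≤ aU → 0 < a₁ → ∃ M₀ : ℕ, ∀ Mc : ℕ, McGuard F Mc → M₀ ≤ Mc →
      (∀ ε₁ : ℝ, 0 < ε₁ → ε₁ ≤ a₁ → B₃ * ε₁ ≤ a₀ → ∀ (k n : ℕ) (V : Literature.MathematicalPhysics.QuantumFieldTheory.Balaban1983to89.GaugeField (F.P (Summit.QuantumFields.YangMills.Theorems.K0RecordFormatNames.recordK₀ F Mc k + n)) (k + 1) (Literature.MathematicalPhysics.QuantumFieldTheory.Balaban1983to89.Node00.SU 2)), Literature.MathematicalPhysics.QuantumFieldTheory.Balaban1983to89.PlaqSmall ε₁ V → Literature.MathematicalPhysics.QuantumFieldTheory.Balaban1983to89.Node00.UkExists F 2 (Summit.QuantumFields.YangMills.Theorems.K0RecordFormatNames.recordK₀ F Mc k + n) (k + 1) a₀ V ∧ Literature.MathematicalPhysics.QuantumFieldTheory.Balaban1983to89.Node00.UniqueUkOrbit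 F 2 (Summit.QuantumFields.YangMills.Theorems.K0RecordFormatNames.recordK₀ F Mc k + n) (k + 1) a₀ V))
    (hBg : ∀ F : T4Family, ∃ aB : ℝ, 0 < aB ∧ ∀ a₀ : ℝ, 0 < a₀ → a₀ ≤ aB → ∃ M₀ : ℕ, ∀ Mc : ℕ, McGuard F Mc → M₀ ≤ Mc →
      (∀ (k n : ℕ) (ε₂₉ : ℝ), 0 < ε₂₉ → letI θ := Summit.QuantumFields.YangMills.Theorems.K0RecordFormatNames.thetaFill F a₀ ε₂₉; letI := θ.instVβ₁; letI := θ.instVβ₂; letI := θ.instιβ; AnalyticAt ℝ (fun B : Summit.QuantumFields.YangMills.Theorems.K0RecordFormatNames.recordW F a₀ ε₂₉ k (Summit.QuantumFields.YangMills.Theorems.K0RecordFormatNames.recordK₀ F Mc k + n) => fun (b : Literature.MathematicalPhysics.QuantumFieldTheory.Balaban1983to89.PBond (F.P (Summit.QuantumFields.YangMills.Theorems.K0RecordFormatNames.recordK₀ F Mc k + n)) 0) (i i' : Fin 2) => ((Summit.QuantumFields.YangMills.Theorems.K0RecordFormatNames.recordBgField F θ k (Summit.QuantumFields.YangMills.Theorems.K0RecordFormatNames.recordK₀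 F Mc k + n) B b : Literature.MathematicalPhysics.QuantumFieldTheory.Balaban1983to89.Node00.SU 2) : Matrix (Fin 2) (Fin 2) ℂ) i i') 0))
    (hTok : ∀ F : T4Family, ∃ aT : ℝ, 0 < aT ∧ ∀ a₀ : ℝ, 0 < a₀ → a₀ ≤ aT → ∃ M₀ : ℕ, ∀ Mc : ℕ, McGuard F Mc → M₀ ≤ Mc → Tok F Mc a₀)
    (hOrbC : ∀ F : T4Family, ∃ aO : ℝ, 0 < aO ∧ ∀ a₀ : ℝ, 0 < a₀ → a₀ ≤ aO → ∃ M₀ : ℕ, ∀ Mc : ℕ, McGuard F Mc → M₀ ≤ Mc → ∀ ε₂₉ : ℝ, 0 < ε₂₉ →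
      letI θ := thetaFill F a₀ ε₂₉; letI := θ.instVβ₁; letI := θ.instVβ₂; letI := θ.instιβ;
      (∀ (k n : ℕ) (a : θ.ιβ) (l : RespLabel F k (recordK₀ F Mc k + n)), RootedResponseOrbitAt F θ k (recordK₀ F Mc k + n) a l)) :
    Summit.QuantumFields.YangMills.Theses.BalabanUVNodes.Record13SepCoPHInhabitedAx := by
  refine record13SepCoPHInhabitedAx_of_chartRowsBox_cofinalRadii fun F a ha => ?_
  obtain ⟨Mth, h8F⟩ := h8 F
  obtain ⟨aO, haO, hO⟩ := hOrbC F
  obtain ⟨a₀, ha₀', hle, hAM⟩ := joinAntecedentsRadiusFirst_of_residual Tok F (hUk F) (hBg F) (hTok F) (min a aO) (lt_min ha haO)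
  obtain ⟨MO, hMO⟩ := hO a₀ ha₀' (hle.trans (min_le_right _ _))
  obtain ⟨Mc, hMc, j, c, c₀, c₁, B₃, B₃', a₁, hAnt⟩ := hAM (max Mth MO)
  obtain ⟨hG0, hc, hc₀, hc₁, hB₃, hB₃', ha₀, ha₁, hThm, hGauge, hUk', hBg', hP9⟩ := hAnt
  obtain ⟨γ₀, ε₂₉, E₀, κ, α₀, α₁, hγ₀, hε, hE₀, hκ, hα₀, hα₁, hD⟩ :=
    h8F Mc ((le_max_left _ _).trans hMc) j c c₀ c₁ B₃ B₃' a₀ a₁ hG0 hc hc₀ hc₁ hB₃ hB₃' ha₀ ha₁ hThm hGauge hUk' hBg' (hBr F Mc a₀ hP9)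
  letI θ := thetaFill F a₀ ε₂₉; letI := θ.instVβ₁; letI := θ.instVβ₂; letI := θ.instιβ
  obtain ⟨ιC, hsw, h9⟩ :=
    chartRowsBox_of_orbit F Mc a₀ ε₂₉ ha₀ (hMO Mc hG0 ((le_max_right _ _).trans hMc) ε₂₉ hε) fun k n => (hBg' k n ε₂₉ hε).contDiffAt
  refine ⟨a₀, ha₀, hle.trans (min_le_left _ _), min γ₀ (1 / 2), ε₂₉, E₀, κ, 4 * (Mc : ℝ), α₀, α₁, Mc, lt_min hγ₀ (by norm_num), min_le_right _ _, hε,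
    hE₀, hκ, hα₀, hα₁, hG0, le_rfl, ιC, fun k v hv => hD k v ?_, hsw, h9⟩
  exact mem_box.mpr fun i => ⟨(mem_box.mp hv i).1, (mem_box.mp hv i).2.trans (min_le_left _ _)⟩

/-! ## §3  ★★★ The junction's binder `hβc` ⟸ cofinal ⁸ ∧ (R-Uk) ∧ (R-Bg) ∧ (R-Tok) ∧ (R-Orb) ∧ (R-Win₁) -/

/-- ★★★ **THE JUNCTION's BINDER `hβc` VERBATIM — `∀ F a, 0 < a → CofinalBetaSocketAxBody F a` — WITH EVERY DISPLAYED BINDER IN CEILING-AND-FLOOR SHAPE**: cofinal ⁸ (`∀ εw > 0, Sig8LR4BoxBelow F εw`;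
radius guarded by the JOIN's antecedents) ∧ (R-Uk) ∧ (R-Bg) ∧ (R-Tok) ∧ (R-Orb) ∧ (R-Win₁) (the Hessian-continuity row and ONE sign letter at ONE level `γw ≤ ½` for every `ε₂₉ ≤ εw`, below
a family radius `aW(F)`).  Order of reading (◆'s (Q-ord) check): radius `a₀ ≤ min a (min aO aW)` from ✓`joinAntecedentsRadiusFirst_of_residual`; window `(εw, γw)` at `a₀`; ⁸-below at `εw` →
`Mth`; (R-Orb)'s floor `M₀ᴼ` at `a₀`; supply at `max Mth M₀ᴼ` → `Mc`, the thirteen antecedents at `a₀`; ⁸ at the JOIN's letters → `ε₂₉ ≤ εw`, `γ₀`; rows ✓`chartRowsBox_of_orbit` from the orbit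
rows at `(a₀, Mc, ε₂₉)` + antecedent (12); the two letters at `(ε₂₉, γw)` restricted to the level `min γ₀ γw` (`ContinuousOn.mono` ∘ ✓`box_mono`; §1); ✓№10
`cofinalBetaSocketAxBody_of_chartRowsBox_hessBox_negPart` at radius `a₀ ≤ a`, level `min γ₀ γw ≤ ½`, `Mg := 4·Mc`, D1 restricted by `mem_box`.  CONDITIONAL; every hypothesis OPEN
Bałaban-strength content inhabited NOWHERE; the junction's consumer, K0ᴬ 27238, K1ᴬ 27239 remain OPEN; NODE O 0∕1; the Yang–Mills mass gap is NOT proved.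
[cite: Balaban1987RG1, Thm 2 (0.31) p.259, Thm 3 p.264, (1.18)–(1.22) pp.263–264, (4.35) p.290, (5.38)–(5.44) pp.296–297; Balaban1985Variational, Thm 1 (8)–(9) p.279, Prop. 6 p.295,
Prop. 9 p.309, (176)–(178) p.306] -/
theorem cofinalBetaSocketAxBody_allRadii_of_sig8LR4BoxCofinal_residual_orbC_winC (Tok : T4Family → ℕ → ℝ → Prop)
    (hBr : ∀ (F : T4Family) (Mc : ℕ) (a₀ : ℝ), Tok F Mc a₀ → TokP9L4Old F Mc a₀)
    (h8c : ∀ (F : T4Family) (εw : ℝ), 0 < εw → Sig8LR4BoxBelow F εw)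
    (hUk : ∀ F : T4Family, ∃ aU : ℝ, 0 < aU ∧ ∀ (B₃ a₀ a₁ : ℝ), 2 * (F.L : ℝ) ^ 2 ≤ B₃ → 0 < a₀ → a₀ ≤ aU → 0 < a₁ → ∃ M₀ : ℕ, ∀ Mc : ℕ, McGuard F Mc → M₀ ≤ Mc →
      (∀ ε₁ : ℝ, 0 < ε₁ → ε₁ ≤ a₁ → B₃ * ε₁ ≤ a₀ → ∀ (k n : ℕ) (V : Literature.MathematicalPhysics.QuantumFieldTheory.Balaban1983to89.GaugeField (F.P (Summit.QuantumFields.YangMills.Theorems.K0RecordFormatNames.recordK₀ F Mc k + n)) (k + 1) (Literature.MathematicalPhysics.QuantumFieldTheory.Balaban1983to89.Node00.SU 2)), Literature.MathematicalPhysics.QuantumFieldTheory.Balaban1983to89.PlaqSmall ε₁ V → Literature.MathematicalPhysics.QuantumFieldTheory.Balaban1983to89.Node00.UkExists F 2 (Summit.QuantumFields.YangMills.Theorems.K0RecordFormatNames.recordK₀ F Mc k + n) (k + 1) a₀ V ∧ Literature.MathematicalPhysics.QuantumFieldTheory.Balaban1983to89.Node00.UniqueUkOrbit F 2 (Summit.QuantumFields.YangMills.Theorems.K0RecordFormatNames.recordK₀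 F Mc k + n) (k + 1) a₀ V))
    (hBg : ∀ F : T4Family, ∃ aB : ℝ, 0 < aB ∧ ∀ a₀ : ℝ, 0 < a₀ → a₀ ≤ aB → ∃ M₀ : ℕ, ∀ Mc : ℕ, McGuard F Mc → M₀ ≤ Mc →
      (∀ (k n : ℕ) (ε₂₉ : ℝ), 0 < ε₂₉ → letI θ := Summit.QuantumFields.YangMills.Theorems.K0RecordFormatNames.thetaFill F a₀ ε₂₉; letI := θ.instVβ₁; letI := θ.instVβ₂; letI := θ.instιβ; AnalyticAt ℝ (fun B : Summit.QuantumFields.YangMills.Theorems.K0RecordFormatNames.recordW F a₀ ε₂₉ k (Summit.QuantumFields.YangMills.Theorems.K0RecordFormatNames.recordK₀ F Mc k + n) => fun (b : Literature.MathematicalPhysics.QuantumFieldTheory.Balaban1983to89.PBond (F.P (Summit.QuantumFields.YangMills.Theorems.K0RecordFormatNames.recordK₀ F Mc k + n)) 0) (i i' : Fin 2) => ((Summit.QuantumFields.YangMills.Theorems.K0RecordFormatNames.recordBgField F θ k (Summit.QuantumFields.YangMills.Theorems.K0RecordFormatNames.recordK₀ F Mc k + n) B b : Literature.MathematicalPhysics.QuantumFieldTheory.Balaban1983to89.Node00.SU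 2) : Matrix (Fin 2) (Fin 2) ℂ) i i') 0))
    (hTok : ∀ F : T4Family, ∃ aT : ℝ, 0 < aT ∧ ∀ a₀ : ℝ, 0 < a₀ → a₀ ≤ aT → ∃ M₀ : ℕ, ∀ Mc : ℕ, McGuard F Mc → M₀ ≤ Mc → Tok F Mc a₀)
    (hOrbC : ∀ F : T4Family, ∃ aO : ℝ, 0 < aO ∧ ∀ a₀ : ℝ, 0 < a₀ → a₀ ≤ aO → ∃ M₀ : ℕ, ∀ Mc : ℕ, McGuard F Mc → M₀ ≤ Mc → ∀ ε₂₉ : ℝ, 0 < ε₂₉ →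
      letI θ := thetaFill F a₀ ε₂₉; letI := θ.instVβ₁; letI := θ.instVβ₂; letI := θ.instιβ;
      (∀ (k n : ℕ) (a : θ.ιβ) (l : RespLabel F k (recordK₀ F Mc k + n)), RootedResponseOrbitAt F θ k (recordK₀ F Mc k + n) a l))
    (hWinC : ∀ F : T4Family, ∃ aW : ℝ, 0 < aW ∧ ∀ a₀ : ℝ, 0 < a₀ → a₀ ≤ aW → ∃ εw γw : ℝ, 0 < εw ∧ 0 < γw ∧ γw ≤ 1 / 2 ∧ ∀ ε₂₉ : ℝ, 0 < ε₂₉ → ε₂₉ ≤ εw →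
      (letI θ := thetaFill F a₀ ε₂₉; letI := θ.instVβ₁; letI := θ.instVβ₂; letI := θ.instιβ;
       (∀ k K : ℕ, ContinuousOn (fun v : Fin (k + 1) → ℝ => fderiv ℝ (fderiv ℝ (B12PolarizationTensor120.expChart (recordTermsAx F a₀ ε₂₉ k v K) θ.ρ8)) 0) (FlowStep.Box γw k))) ∧ ∃ e : ℕ → ℝ, RecordPlimMomentNegPartOnBoxAx F a₀ ε₂₉ γw e) :
    ∀ F : T4Family, ∀ a : ℝ, 0 < a → CofinalBetaSocketAxBody F a := by
  intro F a ha
  obtain ⟨aO, haO, hO⟩ := hOrbC F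
  obtain ⟨aW, haW, hWa⟩ := hWinC F
  obtain ⟨a₀, ha₀', hle, hAM⟩ :=
    joinAntecedentsRadiusFirst_of_residual Tok F (hUk F) (hBg F) (hTok F) (min a (min aO aW)) (lt_min ha (lt_min haO haW))
  have hleA : a₀ ≤ a := hle.trans (min_le_left _ _)
  have hleO : a₀ ≤ aO := hle.trans ((min_le_right _ _).trans (min_le_left _ _))
  have hleW : a₀ ≤ aW := hle.trans ((min_le_right _ _).trans (min_le_right _ _))
  obtain ⟨εw, γw, hεw, hγw, hγh, hW⟩ := hWa a₀ ha₀' hleW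
  obtain ⟨Mth, h8F⟩ := h8c F εw hεw
  obtain ⟨MO, hMO⟩ := hO a₀ ha₀' hleO
  obtain ⟨Mc, hMc, j, c, c₀, c₁, B₃, B₃', a₁, hAnt⟩ := hAM (max Mth MO)
  obtain ⟨hG0, hc, hc₀, hc₁, hB₃, hB₃', ha₀, ha₁, hThm, hGauge, hUk', hBg', hP9⟩ := hAnt
  obtain ⟨γ₀, ε₂₉, E₀, κ, α₀, α₁, hγ₀, hε, hεle, hE₀, hκ, hα₀, hα₁, hD⟩ :=
    h8F Mc ((le_max_left _ _).trans hMc) j c c₀ c₁ B₃ B₃' a₀ a₁ hG0 hc hc₀ hc₁ hB₃ hB₃' ha₀ ha₁ hThm hGauge hUk' hBg' (hBr F Mc a₀ hP9)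
  letI θ := thetaFill F a₀ ε₂₉; letI := θ.instVβ₁; letI := θ.instVβ₂; letI := θ.instιβ
  obtain ⟨ιC, hsw, h9⟩ :=
    chartRowsBox_of_orbit F Mc a₀ ε₂₉ ha₀ (hMO Mc hG0 ((le_max_right _ _).trans hMc) ε₂₉ hε) fun k n => (hBg' k n ε₂₉ hε).contDiffAt
  obtain ⟨hH, e, hN⟩ := hW ε₂₉ hε hεle
  -- ⁸'s level and the window's single level, met at `min γ₀ γw`
  have hγ₁ : 0 < min γ₀ γw := lt_min hγ₀ hγw
  have hγh' : min γ₀ γw ≤ 1 / 2 := (min_le_right _ _).trans hγh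
  refine cofinalBetaSocketAxBody_of_chartRowsBox_hessBox_negPart (Mg := 4 * (Mc : ℝ)) hE₀ hκ F a₀ ε₂₉ (min γ₀ γw) α₀ α₁ ha₀ hleA hγ₁ hγh' hε
    hα₀ hα₁ Mc hG0 le_rfl ιC (fun k v hv => hD k v ?_) hsw h9 (fun k K => (hH k K).mono (box_mono (min_le_right _ _) k))
    (recordPlimMomentNegPartOnBoxAx_of_le (min_le_right _ _) hN)
  exact mem_box.mpr fun i => ⟨(mem_box.mp hv i).1, (mem_box.mp hv i).2.trans (min_le_left _ _)⟩

-- standard axioms only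
#print axioms recordPlimMomentNegPartOnBoxAx_of_le
#print axioms record13SepCoPHInhabitedAx_of_sig8LR4Box_residual_orbC
#print axioms cofinalBetaSocketAxBody_allRadii_of_sig8LR4BoxCofinal_residual_orbC_winC

end Summit.QuantumFields.YangMills.Theorems.K0AxJoinResidualBoxCeilings
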